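import Literature.AlgebraicGeometry.Resolution.ArithmeticalThreefoldsLocalDescentInertiaHensel
import Literature.AlgebraicGeometry.Resolution.DecompositionLayerStrictParameters
import HarnessLib

/-!
# The reduction `Thm. 1.5 ⇒ Prop. 4.10` with the decomposition layer of [CoP1] Prop. 9.3 replaced by its geometric head

Topic: `Literature/AlgebraicGeometry/Resolution`. PROOF side of `CossartPiltant2019ReductionP`
(`ArithmeticalThreefoldsLocal.lean`), input (C4). In
`cossartPiltant2019ReductionP_of_cjs_of_stableInertiaHensel`
(`ArithmeticalThreefoldsLocalDescentInertiaHensel.lean`) the decomposition layer of [CoP1]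
Prop. 9.3 enters as the hypothesis `hDec` (`(LU K′) ⇒ (LU M)` for `M ≤ K′ ≤ Kˢ`). By
`exists_localUniformization_of_head` (`DecompositionLayerAssembly.lean`) `hDec` follows from
its GEOMETRIC HEAD — [CoP1] Prop. 8.1 (1)–(2) applied to the normal local model `R₁′` of `K′`
above a normal model `R₁` of `M`, together with the choice (46) of the `fᵢ` — everything else in
the printed proof of Prop. 9.3 (Galois approximation (44), "`R₁` lies dense in `R₁′`", (47),
(48)–(52), Zariski's Main Theorem, "(45) `R` regular since `S′` is") being kernel-checked
(`DecompositionLayerAssembly.lean`, `DecompositionLayerStrictParameters.lean`).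
This file records the resulting form of the reduction:

* `cossartPiltant2019ReductionP_of_cjs_of_stableInertia_of_head` — PROVED:
  `CossartPiltant2019Local → CossartPiltant2019Principalization → CossartJannsenSaito2020General →
  (embedded resolution of surfaces) → (hStabLoc) → (hStabIη) → (hHead) →
  CossartPiltant2019ReductionP`,

where `hHead` reads: in the frame, for `N | M` finite Galois, `M ≤ K′ ≤ Kˢ` with `(LU K′)`,
every normal model `S[t₁] ⊆ O ∩ M` of `M` and its integral closure `S[t₁ ∪ t₁′]` in `K′`,
there is a local uniformization `S′ = (S[t′])_𝔪 ⊇ S[t₁ ∪ t₁′]` of `K′` with a regular system of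
parameters `x₀, x₁, x₂` and `0 < r ≤ 3` such that (a) `𝔪_{R₁′} S′ ⊆ (x₀ ⋯ x_{r-1}) S′`,
(b) some `f₀, …, f_{r-1} ∈ M` are units times monomials in `x_{<r}` with non-singular exponent
matrix, (c′) some `f ∈ R₁′ = (S[t₁ ∪ t₁′])_𝔪`, a unit times a monomial in `x_{<r}` in `S′`, has
`t′ ⊆ R₁′[1/f]` ([CoP1] Prop. 8.1 (1)–(2), read for the underlying models, with `f` divisible
by `f₁ ⋯ f_r` as on HAL p. 27, and (46)); the printed step (47) is then a theorem
(`exists_mem_eq_unit_mul_prod_pow`, `DecompositionLayerStrictParameters.lean`).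

Everything is PROVED; no named facts, definitions, instances or notation are introduced.

## Sources

* V. Cossart, O. Piltant, J. Algebra 320 (2008) 1051–1082: Prop. 8.1, proof of Prop. 9.3
  (HAL hal-00139124, pp. 22, 27–28), Lemma 9.4 (p. 29). [CossartPiltant2008]
* V. Cossart, O. Piltant, J. Algebra 529 (2019) 268–535 = arXiv:1412.0868, proof of Prop. 4.10
  (arXiv v1: Prop. 4.8, p. 54). [CossartPiltant2019]
* V. Cossart, U. Jannsen, S. Saito (2020), Thm. 1.2, Cor. 1.5. [CossartJannsenSaito2020]
-/

noncomputable section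

open CategoryTheory AlgebraicGeometry TopologicalSpace IsLocalRing _root_.Polynomial
  _root_.IntermediateField

namespace Literature.AlgebraicGeometry.Resolution

universe u

section Head

variable {S E : Type u} [CommRing S] [Field E] [Algebra S E]

/-- **Cossart–Piltant 2019, Prop. 4.10 from Thm. 1.5, principalization, resolution of excellent
surfaces, the tame and inertia stability inputs, and the GEOMETRIC HEAD of the decomposition
layer of [CoP1] Prop. 9.3** (Prop. 8.1 (1)–(2), model reading, applied to the normal local model of `K′` above a normal
model of `M`, with the choice (46) of the `fᵢ`):
`cossartPiltant2019ReductionP_of_cjs_of_stableInertiaHensel` with `hDec` discharged by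
`exists_localUniformization_of_head'`.
[cite: CossartPiltant2019, Props. 4.3, 4.4 and proof of Prop. 4.10 (arXiv v1: Props. 4.2, 4.3, 4.8, pp. 50–54)]
[cite: CossartPiltant2008, Prop. 8.1, Lemma 9.4, Prop. 9.3 and its proof (HAL pp. 22, 26–30)]
[cite: CossartJannsenSaito2020, Thm. 1.2, Cor. 1.5] -/
theorem cossartPiltant2019ReductionP_of_cjs_of_stableInertia_of_head
    (hloc : CossartPiltant2019Local.{u}) (h44 : CossartPiltant2019Principalization.{u})
    (hCJS : CossartJannsenSaito2020General.{u})
    (hEmb : ∀ (Z : Scheme.{u}) [IsIntegral Z] [IsNoetherian Z], Scheme.IsRegular Z →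
      Scheme.IsExcellent Z → ∀ (X : Set Z), IsClosed X → X ≠ Set.univ → topologicalKrullDim X ≤ 2 →
        ∃ (Z' : Scheme.{u}) (π : Z' ⟶ Z), IsProper π ∧ Function.Surjective π.base ∧
          (∃ U : Z.Opens, (U : Set Z) = Xᶜ ∧ IsIso (π ∣_ U)) ∧
          IsStrictNormalCrossingsDivisor Z' (π.base ⁻¹' X))
    (hStabLoc :
      ∀ (p : ℕ), p.Prime →
      ∀ (S : Type u) [CommRing S] [IsDomain S] [IsRegularLocalRing S],
        IsExcellentRing S → ringKrullDim S = 3 → CharP (ResidueField S) p →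
        IsAdicComplete (maximalIdeal S) S →
      ∀ (E : Type u) [Field E] [Algebra S E], Function.Injective (algebraMap S E) →
        IsAlgClosed E → Algebra.IsAlgebraic S E →
      ∀ (OE : ValuationSubring E), (∀ s : S, algebraMap S E s ∈ OE) →
        (∀ s ∈ maximalIdeal S, OE.valuation (algebraMap S E s) < 1) →
        (∀ y : OE, ∃ q : S[X], (∃ i, q.coeff i ∉ maximalIdeal S) ∧
          OE.valuation (q.eval₂ (algebraMap S E) y) < 1) →
      Nonempty OE.valuation.RankOne →
      ∀ (ℓ : ℕ), ℓ.Prime → ℓ ≠ p → ∀ (ζ : E), IsPrimitiveRoot ζ ℓ →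
      ∀ (A : Subfield E), (∀ s : S, algebraMap S E s ∈ A) → ζ ∈ A →
      ∀ (θ : E), θ ∉ A → θ ^ ℓ ∈ A → OE.valuation θ ≤ 1 →
        Module.finrank A (adjoin A ({θ} : Set E)) = ℓ → IsGalois A (adjoin A ({θ} : Set E)) →
        inertiaGroupIn OE (adjoin A ({θ} : Set E)) = ⊤ →
        (∃ t : Finset E, (t : Set E) ⊆ (adjoin A ({θ} : Set E)).toSubfield ∧
          (adjoin A ({θ} : Set E)).toSubfield ≤
            Subfield.closure (Set.range (algebraMap S E) ∪ (t : Set E)) ∧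
          ∃ hTO : (Algebra.adjoin S (t : Set E)).toSubring ≤ OE.toSubring,
            IsRegularLocalRing (Localization.AtPrime
              (Ideal.comap (Subring.inclusion hTO) (maximalIdeal OE)))) →
        (∃ t : Finset E, (t : Set E) ⊆ (adjoin A ({θ} : Set E)).toSubfield ∧
          (adjoin A ({θ} : Set E)).toSubfield ≤
            Subfield.closure (Set.range (algebraMap S E) ∪ (t : Set E)) ∧
          ∃ hTO : (Algebra.adjoin S (t : Set E)).toSubring ≤ OE.toSubring,
            IsRegularLocalRing (Localization.AtPrime
              (Ideal.comap (Subring.inclusion hTO) (maximalIdeal OE))) ∧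
            ∀ (τ : adjoin A ({θ} : Set E) ≃ₐ[A] adjoin A ({θ} : Set E))
              (x : adjoin A ({θ} : Set E)),
              (x : E) ∈ locAtCentre (Algebra.adjoin S (t : Set E)).toSubring OE →
              ((τ x : adjoin A ({θ} : Set E)) : E) ∈
                locAtCentre (Algebra.adjoin S (t : Set E)).toSubring OE))
    (hStabIη :
      ∀ (p : ℕ), p.Prime →
      ∀ (S : Type u) [CommRing S] [IsDomain S] [IsRegularLocalRing S],
        IsExcellentRing S → ringKrullDim S = 3 → CharP (ResidueField S) p →
        IsAdicComplete (maximalIdeal S) S →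
      ∀ (E : Type u) [Field E] [Algebra S E], Function.Injective (algebraMap S E) →
        IsAlgClosed E → Algebra.IsAlgebraic S E →
      ∀ (OE : ValuationSubring E), (∀ s : S, algebraMap S E s ∈ OE) →
        (∀ s ∈ maximalIdeal S, OE.valuation (algebraMap S E s) < 1) →
        (∀ y : OE, ∃ q : S[X], (∃ i, q.coeff i ∉ maximalIdeal S) ∧
          OE.valuation (q.eval₂ (algebraMap S E) y) < 1) →
      Nonempty OE.valuation.RankOne →
      ∀ (M : Subfield E), (∀ s : S, algebraMap S E s ∈ M) →
      ∀ (N : IntermediateField M E) [FiniteDimensional M N] [IsGalois M N],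
      ∀ (η : E), η ∈ OE → η ∈ (lift (fixedField (inertiaGroupIn OE N))).toSubfield →
        (∃ F : Polynomial E, F.Monic ∧
          (∀ k, F.coeff k ∈ OE ∧
            F.coeff k ∈ (lift (fixedField (decompositionGroupIn OE N))).toSubfield) ∧
          F.eval η = 0 ∧ OE.valuation ((derivative F).eval η) = 1) →
        (lift (fixedField (inertiaGroupIn OE N))).toSubfield =
          (IntermediateField.adjoin (lift (fixedField (decompositionGroupIn OE N))).toSubfield
            ({η} : Set E)).toSubfield →
        (∃ t : Finset E, (t : Set E) ⊆ (lift (fixedField (inertiaGroupIn OE N))).toSubfield ∧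
          (lift (fixedField (inertiaGroupIn OE N))).toSubfield ≤
            Subfield.closure (Set.range (algebraMap S E) ∪ (t : Set E)) ∧
          ∃ hTO : (Algebra.adjoin S (t : Set E)).toSubring ≤ OE.toSubring,
            IsRegularLocalRing (Localization.AtPrime
              (Ideal.comap (Subring.inclusion hTO) (maximalIdeal OE)))) →
        ∃ t : Finset E, (t : Set E) ⊆ (lift (fixedField (inertiaGroupIn OE N))).toSubfield ∧
          (lift (fixedField (inertiaGroupIn OE N))).toSubfield ≤
            Subfield.closure (Set.range (algebraMap S E) ∪ (t : Set E)) ∧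
          ∃ hTO : (Algebra.adjoin S (t : Set E)).toSubring ≤ OE.toSubring,
            IsRegularLocalRing (Localization.AtPrime
              (Ideal.comap (Subring.inclusion hTO) (maximalIdeal OE))) ∧
            (∀ τ ∈ decompositionGroupIn OE N, ∀ x : N,
              (x : E) ∈ locAtCentre (Algebra.adjoin S (t : Set E)).toSubring OE →
              ((τ x : N) : E) ∈ locAtCentre (Algebra.adjoin S (t : Set E)).toSubring OE) ∧
            η ∈ locAtCentre (Algebra.adjoin S (t : Set E)).toSubring OE)
    (hHead :
      ∀ (p : ℕ), p.Prime →
      ∀ (S : Type u) [CommRing S] [IsDomain S] [IsRegularLocalRing S],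
        IsExcellentRing S → ringKrullDim S = 3 → CharP (ResidueField S) p →
        IsAdicComplete (maximalIdeal S) S →
      ∀ (E : Type u) [Field E] [Algebra S E], Function.Injective (algebraMap S E) →
        IsAlgClosed E → Algebra.IsAlgebraic S E →
      ∀ (OE : ValuationSubring E), (∀ s : S, algebraMap S E s ∈ OE) →
        (∀ s ∈ maximalIdeal S, OE.valuation (algebraMap S E s) < 1) →
        (∀ y : OE, ∃ q : S[X], (∃ i, q.coeff i ∉ maximalIdeal S) ∧
          OE.valuation (q.eval₂ (algebraMap S E) y) < 1) →
      Nonempty OE.valuation.RankOne →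
      ∀ (M : Subfield E), (∀ s : S, algebraMap S E s ∈ M) →
      ∀ (N : IntermediateField M E) [FiniteDimensional M N] [IsGalois M N] (K' : Subfield E),
        M ≤ K' → K' ≤ (lift (fixedField (decompositionGroupIn OE N))).toSubfield →
        (∃ t : Finset E, (t : Set E) ⊆ K' ∧
          K' ≤ Subfield.closure (Set.range (algebraMap S E) ∪ (t : Set E)) ∧
          ∃ hTO : (Algebra.adjoin S (t : Set E)).toSubring ≤ OE.toSubring,
            IsRegularLocalRing (Localization.AtPrime
              (Ideal.comap (Subring.inclusion hTO) (maximalIdeal OE)))) →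
      ∀ (t₁ : Finset E), (t₁ : Set E) ⊆ M →
        M ≤ Subfield.closure (Set.range (algebraMap S E) ∪ (t₁ : Set E)) →
        (Algebra.adjoin S (t₁ : Set E)).toSubring ≤ OE.toSubring →
        (∀ x : E, x ∈ M → IsIntegral (Algebra.adjoin S (t₁ : Set E)) x →
          x ∈ Algebra.adjoin S (t₁ : Set E)) →
      ∀ (t₁' : Finset E), (t₁' : Set E) ⊆ K' →
        (∀ x : E, x ∈ K' → (IsIntegral (Algebra.adjoin S (t₁ : Set E)) x ↔
          x ∈ Algebra.adjoin S ((t₁ : Set E) ∪ (t₁' : Set E)))) →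
      ∃ (t' : Finset E) (_ : (t' : Set E) ⊆ K')
        (hTO' : (Algebra.adjoin S (t' : Set E)).toSubring ≤ OE.toSubring)
        (_ : Algebra.adjoin S ((t₁ : Set E) ∪ (t₁' : Set E)) ≤ Algebra.adjoin S (t' : Set E))
        (_ : IsRegularLocalRing (locAtCentre (Algebra.adjoin S (t' : Set E)).toSubring OE))
        (r : ℕ) (hr : r ≤ 3) (_ : 0 < r)
        (x : Fin 3 → locAtCentre (Algebra.adjoin S (t' : Set E)).toSubring OE),
        (∀ j, ((x j : locAtCentre (Algebra.adjoin S (t' : Set E)).toSubring OE) : E) ≠ 0) ∧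
        (haveI := isLocalRing_locAtCentre hTO'
         Ideal.span (Set.range x) =
           maximalIdeal (locAtCentre (Algebra.adjoin S (t' : Set E)).toSubring OE)) ∧
        (∀ y : locAtCentre (Algebra.adjoin S (t' : Set E)).toSubring OE,
          (y : E) ∈ locAtCentre (Algebra.adjoin S ((t₁ : Set E) ∪ (t₁' : Set E))).toSubring OE →
          OE.valuation (y : E) < 1 →
          y ∈ Ideal.span {∏ i : Fin r, x (Fin.castLE hr i)}) ∧
        (∃ (f : Fin r → E) (γ : Fin r → (locAtCentre (Algebra.adjoin S (t' : Set E)).toSubring OE)ˣ)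
            (a : Matrix (Fin r) (Fin r) ℕ),
          (∀ i, f i ∈ M) ∧
          (∀ i, f i = ((γ i : locAtCentre (Algebra.adjoin S (t' : Set E)).toSubring OE) : E) *
            ∏ j, ((x (Fin.castLE hr j) :
              locAtCentre (Algebra.adjoin S (t' : Set E)).toSubring OE) : E) ^ a i j) ∧
          (a.map (fun n : ℕ => (n : ℤ))).det ≠ 0) ∧
        (∃ (f₁ : E) (w : (locAtCentre (Algebra.adjoin S (t' : Set E)).toSubring OE)ˣ)
            (e : Fin r → ℕ),
          f₁ ∈ locAtCentre (Algebra.adjoin S ((t₁ : Set E) ∪ (t₁' : Set E))).toSubring OE ∧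
          f₁ = ((w : locAtCentre (Algebra.adjoin S (t' : Set E)).toSubring OE) : E) *
            ∏ i, ((x (Fin.castLE hr i) :
              locAtCentre (Algebra.adjoin S (t' : Set E)).toSubring OE) : E) ^ e i ∧
          ∀ z ∈ (t' : Set E), ∃ n : ℕ,
            f₁ ^ n * z ∈
              locAtCentre (Algebra.adjoin S ((t₁ : Set E) ∪ (t₁' : Set E))).toSubring OE)) :
    CossartPiltant2019ReductionP.{u} :=
  cossartPiltant2019ReductionP_of_cjs_of_stableInertiaHensel hloc h44 hCJS hEmb hStabLoc hStabIη
    (fun p hp S _ _ _ hS hSdim hSchar hScomp E _ _ hinj hE halg OE hSO hdom hres hrk M hSM N _ _ K'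
        hMK' hK'Z hLUK' => by
      haveI := halg
      exact exists_localUniformization_of_head' hS hinj hScomp OE hSO hdom hres M hSM N K' hMK'
        hK'Z hLUK' (hHead p hp S hS hSdim hSchar hScomp E hinj hE halg OE hSO hdom hres hrk M hSM
          N K' hMK' hK'Z hLUK'))

end Head

end Literature.AlgebraicGeometry.Resolution

end
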